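import Summits.MatrixMultiplication.MatrixMultiplication.Theorems.EdgePencilStarConvexity
import HarnessLib

/-!
# THE THRESHOLD OF TROPICAL DOMINATION: `TROP_c(n,2) ∧ leaf ⟹ ω(K₄) ≤ c` for every real threshold `c`
# (modulo star-convexity), `TROP_ψ(n,e) ⟺ χ(log_n e) ≤ ψ`, and the star-inertness of the registered line

Support kernel for `stmt-MatrixMultiplication-26697` (`TetraExcessZero : ω(K₄) ≤ ω(2,1,2) =: ψ`, route
`TetrahedronCarving`; cut of record `closes (TetraExcessZero) (TetraPlusTwo) : ω = 2`, UNCHANGED; lineage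
`decomp-mm-lens-6`, generation 45; sequel of `EdgePencilStarConvexity`). No item is added or changed; no
definition is introduced. Notation as there: `X₄(F)`, `[t]`, `W_n^{(e)} = sixTetra F n e`, `D_n = W_n^{(1)}`,
`T(K₄)_n = tetra F n`, `R̃ = asympRankOf (· ≤ ·)`, `χ(δ) = omegaSix F δ`, `ψ = ω(2,1,2)`, `T = ω(K₄)`; `hSC` is the
inline star-convexity hypothesis of `EdgePencilStarConvexity` (for `φ ∈ X₄` and `λ ∈ (0,1)` a point `φ'` with
`φ'[W_m^{(e)}] = (e·m²)^λ φ[W_m^{(e)}]^{1−λ}`), never a tree fact. The THRESHOLD-`c` tropical domination at base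
`n`, thickness `e` (inline): `TROP_c(n,e) : ∀ φ ∈ X₄(F), φ[W_n^{(e)}] ≤ max (φ[D_n]) n^c` — the tree's `TROP(n,e)`
(`EdgePencilTropicalPair`) is `c = 4`.

§37 THE CAP IS THE THRESHOLD (`exists_separating_of_blind_of_lt`, `spectrum_diamond_le_of_tropAt_of_blind`,
`omegaTetra_le_of_excessZero_of_tropAt`; by name `omegaTetra_le_of_tetraExcessZero_of_tropAt`): the argument of
`EdgePencilStarConvexity` §31–§32 run at an arbitrary real threshold — a blind point with `φ[D_n] > n^c` interpolates
(towards the vertex flattening, `hSC`) to a point separating `W_n^{(2)}` from `max (D_n, n^c)`; so under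
`TROP_c(n,2)` every blind point has `φ[D_n] ≤ n^c`, and the leaf's blind `T(K₄)_n`-maximal point gives

  `hSC ⟹ (TROP_c(n,2) ∧ ω(K₄) ≤ ψ ⟹ ω(K₄) ≤ c)`   (`n ≥ 2`, every `c : ℝ`).

§38 AT THE RELATIVE THRESHOLD `c = ψ` TROPICAL DOMINATION IS THE RUNG (`tropAt_omegaRect_iff_sixRung`,
`tropAt_omegaRect_two_iff`; no `hSC`): `TROP_ψ(n,e) ⟺ R̃[W_n^{(e)}] ≤ n^ψ = R̃[D_n] ⟺ χ(log_n e) ≤ ψ`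
(`1 ≤ e ≤ n`), because `φ[D_n] ≤ n^ψ` for every `φ`. Consequently the §37 cap applied to a rung reads
`ω(K₄) ≤ ψ` — the leaf itself (`omegaTetra_le_omegaRect_of_excessZero_of_sixRung_mod_hSC`, a tautology recorded
only to make the comparison explicit): THE INTERPOLATION OF `EdgePencilStarConvexity` CAPS `TROP_4` AT `4` BUT
CAPS THE REGISTERED STUBS OF `rung_and_chord` AT NOTHING BELOW `ψ`.

§39 WHY: THE STUB REGIONS ARE INTERPOLATION-CLOSED (`interpolant_le_rpow_of_le_rpow`,
`interpolant_respects_rung`, `interpolant_respects_leaf`): if `φ[W_m^{(e)}] ≤ m^a` with `3 ≤ a` then every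
`hSC`-interpolant has `φ'[W_m^{(e)}] = (e m²)^λ (φ[W_m^{(e)}])^{1−λ} ≤ m^{3λ} m^{a(1−λ)} ≤ m^a`; with `a = ψ ≥ 4`
(`e ≤ m`: rungs `R̃[W_m^{(e)}] ≤ m^ψ`; `e = m`: the leaf `R̃[T(K₄)_m] ≤ m^ψ`) the defining inequalities of
`stub_sixRungPos` (at its base) and of `TetraExcessZero` are preserved by the interpolation, point by point. In
E-coordinates: the half-planes `{d + δp ≤ ψ}` and `{p + d ≤ ψ}` contain the star centre `(1,2)` of the vertex
flattening (`2 + δ ≤ 3 < 4 ≤ ψ`), whereas the `TROP_4` region `{p = 0} ∪ {d ≤ 4 − δp…}` does not contain the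
segment from a blind high point to `(1,2)`. `stub_midTight` is an EXISTENCE statement (a bimaximal point,
`EdgePencilBimaximal`) and is monotone under enlarging the spectrum, so no closure hypothesis can refute it either.

References: Alman–Li–Pratt 2026, Remark 3.2 (arXiv:2604.01386) [AlmanLiPratt2026]; Strassen 1988, Thm. 6.5,
Thm. 3.8 [Strassen1988]; Zuiddam 2018, Cor. 2.13 [Zuiddam2018]; Christandl–Vrana–Zuiddam 2023, Prop. 1.6
[ChristandlVranaZuiddam2023]. No `sorry`, no new axiom, no instance, no notation, no definition.
-/

noncomputable section

set_option linter.dupNamespace false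

open Finset Literature.Computability.AlgebraicComplexity
open Summit.MatrixMultiplication.MatrixMultiplication.Theorems.TetrahedronTensor
open Summit.MatrixMultiplication.MatrixMultiplication.Theorems.TetraDiagonal
open Summit.MatrixMultiplication.MatrixMultiplication.Theses.TetrahedronCarving

namespace Summit.MatrixMultiplication.MatrixMultiplication.Theorems.EdgePencil

/-! ## §37 The cap is the threshold -/

section Threshold

variable (F : Type) [Field F]

/-- **THE SEPARATING INTERPOLANT AT THRESHOLD `N`**: under `hSC`, a point blind at base `n`
(`φ[W_n^{(2)}] = φ[D_n]`) with `φ[D_n] > N > 0` yields `φ'` with `φ'[W_n^{(2)}] > max (φ'[D_n]) N`.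
[cite: AlmanLiPratt2026, Remark 3.2] -/
theorem exists_separating_of_blind_of_lt
    (hSC : ∀ φ ∈ DTensorClass.asymptoticSpectrumDTensors F 2, ∀ l : ℝ, 0 < l → l < 1 →
      ∃ φ' ∈ DTensorClass.asymptoticSpectrumDTensors F 2, ∀ m e : ℕ, 1 ≤ e → e ≤ m →
        φ' (DTensorClass.mk (sixTetra F m e)) =
          ((e : ℝ) * (m : ℝ) ^ 2) ^ l * (φ (DTensorClass.mk (sixTetra F m e))) ^ (1 - l))
    {n : ℕ} (hn : 2 ≤ n) {N : ℝ} (hN : 0 < N) {φ : DTensorClass F 4 → ℝ}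
    (hφ : φ ∈ DTensorClass.asymptoticSpectrumDTensors F 2)
    (hbl : φ (DTensorClass.mk (sixTetra F n 2)) = φ (DTensorClass.mk (sixTetra F n 1)))
    (hhigh : N < φ (DTensorClass.mk (sixTetra F n 1))) :
    ∃ φ' ∈ DTensorClass.asymptoticSpectrumDTensors F 2,
      max (φ' (DTensorClass.mk (sixTetra F n 1))) N < φ' (DTensorClass.mk (sixTetra F n 2)) := by
  have hn0' : (0 : ℝ) < n := by exact_mod_cast (show 0 < n by omega)
  have hc : (0 : ℝ) < 2 * (n : ℝ) ^ 2 := by positivity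
  have hDpos : 0 < φ (DTensorClass.mk (sixTetra F n 1)) := lt_trans hN hhigh
  obtain ⟨l, hl0, hl1, hlt⟩ := exists_exponent_interpolate_gt hc hN hhigh
  obtain ⟨φ', hφ', hφ'eq⟩ := hSC φ hφ l hl0 hl1
  refine ⟨φ', hφ', ?_⟩
  have h2 := hφ'eq n 2 (by norm_num) hn
  have h1 := hφ'eq n 1 le_rfl (by omega)
  rw [hbl] at h2
  push_cast at h1 h2
  rw [one_mul] at h1
  have hDl : 0 < (φ (DTensorClass.mk (sixTetra F n 1))) ^ (1 - l) := Real.rpow_pos_of_pos hDpos _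
  rw [max_lt_iff, h1, h2]
  exact ⟨mul_lt_mul_of_pos_right (Real.rpow_lt_rpow (by positivity) (by nlinarith) hl0) hDl, hlt⟩

/-- **Under `TROP_c(n,2)`, every blind point has `φ[D_n] ≤ n^c`** (modulo `hSC`; `n ≥ 2`, any real `c`).
[cite: AlmanLiPratt2026, Remark 3.2] -/
theorem spectrum_diamond_le_of_tropAt_of_blind
    (hSC : ∀ φ ∈ DTensorClass.asymptoticSpectrumDTensors F 2, ∀ l : ℝ, 0 < l → l < 1 →
      ∃ φ' ∈ DTensorClass.asymptoticSpectrumDTensors F 2, ∀ m e : ℕ, 1 ≤ e → e ≤ m →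
        φ' (DTensorClass.mk (sixTetra F m e)) =
          ((e : ℝ) * (m : ℝ) ^ 2) ^ l * (φ (DTensorClass.mk (sixTetra F m e))) ^ (1 - l))
    {n : ℕ} (hn : 2 ≤ n) (c : ℝ)
    (hT : ∀ φ ∈ DTensorClass.asymptoticSpectrumDTensors F 2,
      φ (DTensorClass.mk (sixTetra F n 2)) ≤ max (φ (DTensorClass.mk (sixTetra F n 1))) ((n : ℝ) ^ c))
    {φ : DTensorClass F 4 → ℝ} (hφ : φ ∈ DTensorClass.asymptoticSpectrumDTensors F 2)
    (hbl : φ (DTensorClass.mk (sixTetra F n 2)) = φ (DTensorClass.mk (sixTetra F n 1))) :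
    φ (DTensorClass.mk (sixTetra F n 1)) ≤ (n : ℝ) ^ c := by
  have hn0' : (0 : ℝ) < n := by exact_mod_cast (show 0 < n by omega)
  by_contra h
  rw [not_le] at h
  obtain ⟨φ', hφ', hlt⟩ := exists_separating_of_blind_of_lt F hSC hn (Real.rpow_pos_of_pos hn0' c) hφ hbl h
  exact absurd (hT φ' hφ') (not_le.2 hlt)

/-- **THE CAP IS THE THRESHOLD**: `hSC ⟹ (TROP_c(n,2) ∧ ω(K₄) ≤ ψ ⟹ ω(K₄) ≤ c)` (`n ≥ 2`, every real `c`): the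
leaf supplies a blind `T(K₄)_n`-maximal point, whose diamond value `n^{ω(K₄)}` is then at most `n^c`.
[cite: AlmanLiPratt2026, Remark 3.2] -/
theorem omegaTetra_le_of_excessZero_of_tropAt
    (hSC : ∀ φ ∈ DTensorClass.asymptoticSpectrumDTensors F 2, ∀ l : ℝ, 0 < l → l < 1 →
      ∃ φ' ∈ DTensorClass.asymptoticSpectrumDTensors F 2, ∀ m e : ℕ, 1 ≤ e → e ≤ m →
        φ' (DTensorClass.mk (sixTetra F m e)) =
          ((e : ℝ) * (m : ℝ) ^ 2) ^ l * (φ (DTensorClass.mk (sixTetra F m e))) ^ (1 - l))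
    {n : ℕ} (hn : 2 ≤ n) (c : ℝ)
    (hT : ∀ φ ∈ DTensorClass.asymptoticSpectrumDTensors F 2,
      φ (DTensorClass.mk (sixTetra F n 2)) ≤ max (φ (DTensorClass.mk (sixTetra F n 1))) ((n : ℝ) ^ c))
    (hA : omegaTetra F ≤ omegaRect F 2 1 2) : omegaTetra F ≤ c := by
  obtain ⟨φ, hφ, hmax, hblind⟩ := (excessZero_iff_exists_blind_maximal F hn).1 hA
  have hn1' : (1 : ℝ) < n := by exact_mod_cast (show 1 < n by omega)
  have hTn : φ (DTensorClass.mk (tetra F n)) = (n : ℝ) ^ omegaTetra F := by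
    rw [hmax, rpow_omegaTetra_eq_asympRank F hn]
  have hW2le : φ (DTensorClass.mk (sixTetra F n 2)) ≤ φ (DTensorClass.mk (tetra F n)) := by
    have h := (DTensorClass.mem_asymptoticSpectrumDTensors_iff.1 hφ).mono
      (mk_sixTetra_mono (F := F) (n := n) hn)
    rwa [sixTetra_of_le le_rfl] at h
  have hbl2 : φ (DTensorClass.mk (sixTetra F n 2)) = φ (DTensorClass.mk (sixTetra F n 1)) :=
    le_antisymm (by rw [← hblind]; exact hW2le) (spectrum_diamond_le_sixTetra (F := F) (by norm_num) hφ)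
  have hD := spectrum_diamond_le_of_tropAt_of_blind F hSC hn c hT hφ hbl2
  rw [← hblind, hTn] at hD
  exact (Real.rpow_le_rpow_left_iff hn1').1 hD

/-- **BY NAME over `ℂ`**: `hSC ⟹ (TROP_c(n,2) ∧ TetraExcessZero ⟹ ω(K₄) ≤ c)`; `c = 4` is
`EdgePencilStarConvexity.omegaTetra_le_four_of_excessZero_of_trop_two`, and since `4 ≤ ω(K₄)` a threshold
`c < 4` makes `TROP_c(n,2)` INCONSISTENT with the leaf (modulo `hSC`). [cite: AlmanLiPratt2026, Remark 3.2] -/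
theorem omegaTetra_le_of_tetraExcessZero_of_tropAt
    (hSC : ∀ φ ∈ DTensorClass.asymptoticSpectrumDTensors ℂ 2, ∀ l : ℝ, 0 < l → l < 1 →
      ∃ φ' ∈ DTensorClass.asymptoticSpectrumDTensors ℂ 2, ∀ m e : ℕ, 1 ≤ e → e ≤ m →
        φ' (DTensorClass.mk (sixTetra ℂ m e)) =
          ((e : ℝ) * (m : ℝ) ^ 2) ^ l * (φ (DTensorClass.mk (sixTetra ℂ m e))) ^ (1 - l))
    {n : ℕ} (hn : 2 ≤ n) (c : ℝ)
    (hT : ∀ φ ∈ DTensorClass.asymptoticSpectrumDTensors ℂ 2,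
      φ (DTensorClass.mk (sixTetra ℂ n 2)) ≤ max (φ (DTensorClass.mk (sixTetra ℂ n 1))) ((n : ℝ) ^ c))
    (hA : TetraExcessZero) : omegaTetra ℂ ≤ c :=
  omegaTetra_le_of_excessZero_of_tropAt ℂ hSC hn c hT hA

/-- … in particular a threshold `c < 4` contradicts the leaf (modulo `hSC`). [cite: AlmanLiPratt2026, Remark 3.2] -/
theorem not_tropAt_of_tetraExcessZero_of_lt_four
    (hSC : ∀ φ ∈ DTensorClass.asymptoticSpectrumDTensors ℂ 2, ∀ l : ℝ, 0 < l → l < 1 →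
      ∃ φ' ∈ DTensorClass.asymptoticSpectrumDTensors ℂ 2, ∀ m e : ℕ, 1 ≤ e → e ≤ m →
        φ' (DTensorClass.mk (sixTetra ℂ m e)) =
          ((e : ℝ) * (m : ℝ) ^ 2) ^ l * (φ (DTensorClass.mk (sixTetra ℂ m e))) ^ (1 - l))
    {n : ℕ} (hn : 2 ≤ n) {c : ℝ} (hc : c < 4) (hA : TetraExcessZero) :
    ¬ ∀ φ ∈ DTensorClass.asymptoticSpectrumDTensors ℂ 2,
      φ (DTensorClass.mk (sixTetra ℂ n 2)) ≤ max (φ (DTensorClass.mk (sixTetra ℂ n 1))) ((n : ℝ) ^ c) :=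
  fun hT => absurd ((omegaTetra_le_of_tetraExcessZero_of_tropAt hSC hn c hT hA).trans_lt hc)
    (not_lt.2 (four_le_omegaTetra ℂ))

end Threshold

/-! ## §38 At the relative threshold, tropical domination is the rung -/

section Relative

variable (F : Type) [Field F]

/-- **`TROP_ψ(n,e) ⟺ χ(log_n e) ≤ ψ`** (`2 ≤ n`, `1 ≤ e ≤ n`; no star-convexity): at the RELATIVE threshold
`n^ψ = R̃[D_n]` the term `φ[D_n] ≤ n^ψ` is redundant, and `∀ φ, φ[W_n^{(e)}] ≤ n^ψ` is `R̃[W_n^{(e)}] ≤ R̃[D_n]`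
(`sixRung_iff_asympRank_le`). [cite: Zuiddam2018, Cor. 2.13] -/
theorem tropAt_omegaRect_iff_sixRung {n e : ℕ} (hn : 2 ≤ n) (he1 : 1 ≤ e) (he : e ≤ n) :
    (∀ φ ∈ DTensorClass.asymptoticSpectrumDTensors F 2,
      φ (DTensorClass.mk (sixTetra F n e)) ≤
        max (φ (DTensorClass.mk (sixTetra F n 1))) ((n : ℝ) ^ omegaRect F 2 1 2)) ↔
      omegaSix F (Real.logb n e) ≤ omegaRect F 2 1 2 := by
  rw [sixRung_iff_asympRank_le F hn he1 he, ← rpow_omegaRect_eq_asympRank_diamond F hn]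
  constructor
  · intro hT
    obtain ⟨φ, hφ, hφeq⟩ :=
      DTensorClass.exists_mem_spectrum_apply_eq_asympRankOf (DTensorClass.mk (sixTetra F n e))
    rw [← hφeq]
    refine (hT φ hφ).trans (max_le ?_ le_rfl)
    rw [rpow_omegaRect_eq_asympRank_diamond F hn]
    exact DTensorClass.le_asympRankOf hφ _
  · intro hR φ hφ
    exact ((DTensorClass.le_asympRankOf hφ _).trans hR).trans (le_max_right _ _)

/-- **`TROP_ψ(n,2) ⟺ χ(log_n 2) ≤ ψ`**, the base-`n` instance of `stub_sixRungPos`. [cite: Zuiddam2018, Cor. 2.13] -/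
theorem tropAt_omegaRect_two_iff {n : ℕ} (hn : 2 ≤ n) :
    (∀ φ ∈ DTensorClass.asymptoticSpectrumDTensors F 2,
      φ (DTensorClass.mk (sixTetra F n 2)) ≤
        max (φ (DTensorClass.mk (sixTetra F n 1))) ((n : ℝ) ^ omegaRect F 2 1 2)) ↔
      omegaSix F (Real.logb n 2) ≤ omegaRect F 2 1 2 :=
  tropAt_omegaRect_iff_sixRung F hn (by norm_num) hn

/-- **THE CAP OF A RUNG IS THE LEAF ITSELF** (modulo `hSC`): the §37 cap at the relative threshold `c = ψ`
concludes `ω(K₄) ≤ ψ`, its own hypothesis — the interpolation that caps `TROP_4 ∧ leaf` at `ω(K₄) ≤ 4`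
extracts NOTHING from `rung ∧ leaf`. Recorded only to make the comparison checkable. [cite: AlmanLiPratt2026, Remark 3.2] -/
theorem omegaTetra_le_omegaRect_of_excessZero_of_sixRung_mod_hSC
    (hSC : ∀ φ ∈ DTensorClass.asymptoticSpectrumDTensors F 2, ∀ l : ℝ, 0 < l → l < 1 →
      ∃ φ' ∈ DTensorClass.asymptoticSpectrumDTensors F 2, ∀ m e : ℕ, 1 ≤ e → e ≤ m →
        φ' (DTensorClass.mk (sixTetra F m e)) =
          ((e : ℝ) * (m : ℝ) ^ 2) ^ l * (φ (DTensorClass.mk (sixTetra F m e))) ^ (1 - l))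
    {n : ℕ} (hn : 2 ≤ n) (hr : omegaSix F (Real.logb n 2) ≤ omegaRect F 2 1 2)
    (hA : omegaTetra F ≤ omegaRect F 2 1 2) : omegaTetra F ≤ omegaRect F 2 1 2 :=
  omegaTetra_le_of_excessZero_of_tropAt F hSC hn (omegaRect F 2 1 2) ((tropAt_omegaRect_two_iff F hn).2 hr) hA

end Relative

/-! ## §39 Why: the stub regions are closed under the interpolation -/

section Closure

variable (F : Type) [Field F]

/-- **Arithmetic of the interpolant**: `0 ≤ x ≤ m^a`, `1 ≤ e ≤ m`, `2 ≤ m`, `3 ≤ a`, `0 < λ < 1` give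
`(e m²)^λ x^{1−λ} ≤ m^a` (`e m² ≤ m³ ≤ m^a`). [folklore] -/
theorem interpolant_le_rpow_of_le_rpow {m e : ℕ} (hm : 2 ≤ m) (he1 : 1 ≤ e) (he : e ≤ m) {a l x : ℝ}
    (ha : 3 ≤ a) (hl0 : 0 < l) (hl1 : l < 1) (hx0 : 0 ≤ x) (hx : x ≤ (m : ℝ) ^ a) :
    ((e : ℝ) * (m : ℝ) ^ 2) ^ l * x ^ (1 - l) ≤ (m : ℝ) ^ a := by
  have hm1 : (1 : ℝ) ≤ m := by exact_mod_cast (show 1 ≤ m by omega)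
  have hm0 : (0 : ℝ) < m := by linarith
  have hem : (e : ℝ) * (m : ℝ) ^ 2 ≤ (m : ℝ) ^ a := by
    calc (e : ℝ) * (m : ℝ) ^ 2 ≤ (m : ℝ) * (m : ℝ) ^ 2 := by
          exact mul_le_mul_of_nonneg_right (by exact_mod_cast he) (by positivity)
      _ = (m : ℝ) ^ (3 : ℝ) := by
          rw [show (3 : ℝ) = ((3 : ℕ) : ℝ) by norm_num, Real.rpow_natCast]
          ring
      _ ≤ (m : ℝ) ^ a := Real.rpow_le_rpow_of_exponent_le hm1 ha
  calc ((e : ℝ) * (m : ℝ) ^ 2) ^ l * x ^ (1 - l)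
      ≤ ((m : ℝ) ^ a) ^ l * ((m : ℝ) ^ a) ^ (1 - l) := by
        exact mul_le_mul (Real.rpow_le_rpow (by positivity) hem hl0.le)
          (Real.rpow_le_rpow hx0 hx (by linarith)) (Real.rpow_nonneg hx0 _) (by positivity)
    _ = (m : ℝ) ^ a := by
        rw [← Real.rpow_mul (by positivity), ← Real.rpow_mul (by positivity), ← Real.rpow_add hm0]
        ring_nf

/-- **RUNGS ARE INTERPOLATION-CLOSED**: if `φ` respects the rung inequality `φ[W_m^{(e)}] ≤ m^ψ` (`1 ≤ e ≤ m`,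
`2 ≤ m`) then so does every `hSC`-interpolant `φ'` of `φ`. With `§38` (`∀ φ, φ[W_m^{(e)}] ≤ m^ψ ⟺ χ(log_m e) ≤ ψ`):
the interpolation of `EdgePencilStarConvexity` cannot refute a rung. [cite: Strassen1988, Thm. 6.5] -/
theorem interpolant_respects_rung {m e : ℕ} (hm : 2 ≤ m) (he1 : 1 ≤ e) (he : e ≤ m) {l : ℝ} (hl0 : 0 < l)
    (hl1 : l < 1) {φ φ' : DTensorClass F 4 → ℝ} (hφ : φ ∈ DTensorClass.asymptoticSpectrumDTensors F 2)
    (hφ'eq : φ' (DTensorClass.mk (sixTetra F m e)) =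
      ((e : ℝ) * (m : ℝ) ^ 2) ^ l * (φ (DTensorClass.mk (sixTetra F m e))) ^ (1 - l))
    (hrung : φ (DTensorClass.mk (sixTetra F m e)) ≤ (m : ℝ) ^ omegaRect F 2 1 2) :
    φ' (DTensorClass.mk (sixTetra F m e)) ≤ (m : ℝ) ^ omegaRect F 2 1 2 := by
  rw [hφ'eq]
  have h1 : 1 ≤ φ (DTensorClass.mk (sixTetra F m e)) := one_le_spectrum_sixTetra (by omega) he1 hφ
  exact interpolant_le_rpow_of_le_rpow hm he1 he (by linarith [four_le_omegaRect_two_one_two F]) hl0 hl1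
    (by linarith) hrung

/-- **THE LEAF IS INTERPOLATION-CLOSED**: if `φ[T(K₄)_m] ≤ m^ψ` (`2 ≤ m`) then every `hSC`-interpolant has
`φ'[T(K₄)_m] ≤ m^ψ` (`T(K₄)_m = W_m^{(m)}`, flattening value `m³ ≤ m^ψ`). With
`EdgePencilBlindMaximal.excessZero_iff_forall_spectrum` (`leaf ⟺ ∀ φ, φ[T(K₄)_m] ≤ R̃[D_m] = m^ψ`): the
interpolation cannot refute the leaf either. [cite: Strassen1988, Thm. 6.5] -/
theorem interpolant_respects_leaf {m : ℕ} (hm : 2 ≤ m) {l : ℝ} (hl0 : 0 < l) (hl1 : l < 1)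
    {φ φ' : DTensorClass F 4 → ℝ} (hφ : φ ∈ DTensorClass.asymptoticSpectrumDTensors F 2)
    (hφ'eq : φ' (DTensorClass.mk (sixTetra F m m)) =
      ((m : ℝ) * (m : ℝ) ^ 2) ^ l * (φ (DTensorClass.mk (sixTetra F m m))) ^ (1 - l))
    (hleaf : φ (DTensorClass.mk (tetra F m)) ≤ (m : ℝ) ^ omegaRect F 2 1 2) :
    φ' (DTensorClass.mk (tetra F m)) ≤ (m : ℝ) ^ omegaRect F 2 1 2 := by
  rw [← sixTetra_of_le (le_refl m)] at hleaf ⊢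
  exact interpolant_respects_rung F hm (by omega) le_rfl hl0 hl1 hφ hφ'eq hleaf

/-- **THE STUB OF RECORD AT ONE BASE IS STAR-INERT** (contrast with
`EdgePencilStarConvexity.not_trop_two_of_excessZero_of_four_lt`): under `hSC`, in ANY world — whatever `ω(K₄)` —
the rung `χ(log_n 2) ≤ ψ` and the leaf together are equivalent to the single family of inequalities
`∀ φ, φ[W_n^{(2)}] ≤ n^ψ ∧ φ[T(K₄)_n] ≤ n^ψ`, each preserved by the interpolation; no bound on `ω(K₄)` below `ψ`
follows. [cite: Zuiddam2018, Cor. 2.13] -/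
theorem sixRung_and_excessZero_iff_forall_spectrum {n : ℕ} (hn : 2 ≤ n) :
    (omegaSix F (Real.logb n 2) ≤ omegaRect F 2 1 2 ∧ omegaTetra F ≤ omegaRect F 2 1 2) ↔
      ∀ φ ∈ DTensorClass.asymptoticSpectrumDTensors F 2,
        φ (DTensorClass.mk (sixTetra F n 2)) ≤ (n : ℝ) ^ omegaRect F 2 1 2 ∧
          φ (DTensorClass.mk (tetra F n)) ≤ (n : ℝ) ^ omegaRect F 2 1 2 := by
  have hrung := sixRung_iff_asympRank_le F hn (by norm_num : 1 ≤ 2) hn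
  rw [Nat.cast_ofNat] at hrung
  rw [hrung, excessZero_iff_asympRank_le F hn, ← rpow_omegaRect_eq_asympRank_diamond F hn]
  constructor
  · rintro ⟨hW, hT⟩ φ hφ
    exact ⟨(DTensorClass.le_asympRankOf hφ _).trans hW, (DTensorClass.le_asympRankOf hφ _).trans hT⟩
  · intro h
    obtain ⟨φ₁, hφ₁, h₁⟩ :=
      DTensorClass.exists_mem_spectrum_apply_eq_asympRankOf (DTensorClass.mk (sixTetra F n 2))
    obtain ⟨φ₂, hφ₂, h₂⟩ :=
      DTensorClass.exists_mem_spectrum_apply_eq_asympRankOf (DTensorClass.mk (tetra F n))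
    exact ⟨h₁ ▸ (h φ₁ hφ₁).1, h₂ ▸ (h φ₂ hφ₂).2⟩

end Closure

end Summit.MatrixMultiplication.MatrixMultiplication.Theorems.EdgePencil

end
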